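import Literature.NumberTheory.Automorphic.Liu2021.AlbaneseMapEpiOfSurjective
import HarnessLib

/-!
# Liu 2021 §2.1 / §4.2: every GEOMETRIC point of `∇X_K` lifts along `∇u^{K'}_K` — the `Ω`-form, `Ω` any algebraically closed field

[Liu2021] = Yifeng Liu, *Fourier–Jacobi cycles and arithmetic relative trace formula*, Camb. J. Math. **9** (2021) =
arXiv:2102.11518 (`FJcycle.tex` line numbers as in `Liu2021/AppendixC/Glue.lean`).  PROOF FILE (theorems only; no definition, no
named fact, no instance, no `sorry`) over the carriers `AppendixC.Nabla` (Def. 2.1 (1): «the smallest open and closed subscheme of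
`X × X` containing the diagonal `ΔX`», with `∇u` the restriction of `u × u`, l. 1171–1176) and the §4.2 datum `AppendixC.Sec42Data`
(fields `nablaTr`, `nablaTr_incl`).  Sequel of ★ `Liu2021/NablaMapSurjectiveOfPieces` (`Nabla.exists_comp_eq_of_pieces_lift`: every
`ℂ`-point of `∇X` lifts along `∇u` as soon as same-piece pairs of complex points lift along `u`), ★ `Liu2021/NablaMapSurjectiveOfSurjective`
(`Nabla.pieces_lift_of_surjective`) and ★ `Liu2021/AlbaneseMapEpiOfSurjective` (`Nabla.surjective_left_of_surjective_of_smooth`: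
`∇u` is a SURJECTIVE morphism of schemes; `SchemeOver.surjective_left_of_forall_algPoints`).

Those files read points over `ℂ` (through a fixed `k ⊆ ℂ`).  The reduction arguments of the cell's FLOOR-0 programme F0P5a
(ED4-CUT-LETTER v0 §8 step 3, row **U**: «choose `x̃ ∈ M⋆_N(Ω)` over `x` and `ỹ` over `y` IN THE SAME `N`-component, so that
`(x̃, ỹ) ∈ ∇_N`») read points over `Ω = \overline{F_w}` — an ABSTRACT algebraically closed field over the base, not `ℂ`.  This file
supplies the `Ω`-form: once `∇u` is known to be surjective AS A MORPHISM OF SCHEMES (from the complex pieces), `Ω`-points lift along it for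
EVERY algebraically closed `Ω` over `k` by the Nullstellensatz (★ `Morphisms.exists_over_comp_eq_of_surjective`: geometric points lift
along surjective morphisms locally of finite type, [GortzWedhorn2020] Cor. 3.36 / Prop. 4.8).

## What is proved (`k` a field with `[Algebra k ℂ]` where complex pieces are used; `Ω` algebraically closed with `[Algebra k Ω]`)

* `SchemeOver.exists_algPoints_comp_eq_of_surjective` — `Ω`-points of `Z` lift along any `g : W → Z` over `k` with `g` surjective and
  locally of finite type (★ `Morphisms.exists_over_comp_eq_of_surjective` in `AlgPoints` clothing).
* `Nabla.surjective_left_of_pieces_lift` — **`∇u : ∇Y → ∇X` is a SURJECTIVE morphism of schemes** for `u : Y → X` over `k ⊆ ℂ` of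
  characteristic zero with `X` smooth of relative dimension `d` and projective, `Y` projective, ANY carriers and `ν` over `u × u`, given
  colimit cofans of geometrically irreducible complex pieces of `X_ℂ`, a geometrically irreducible family over `Y_ℂ` and the SAME-PIECE
  LIFTING of pairs of complex points along `u` (the hypothesis `hlift` of ★ `Nabla.exists_comp_eq_of_pieces_lift`, supplied for Shimura
  curves by ★ `RecordSystemGS.pieces_pair_lift` and for every surjective `u` by ★ `Nabla.pieces_lift_of_surjective`).
* `Nabla.exists_comp_eq_algPoints_of_pieces_lift` ∕ `Nabla.exists_comp_eq_algPoints_of_surjective_of_smooth` — hence **every `Ω`-point of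
  `∇X` lifts along `∇u` to an `Ω`-point of `∇Y`**, for EVERY algebraically closed `Ω` over `k` (pieces-lift form ∕ `u` surjective with
  `Y` smooth projective form).
* `Nabla.exists_comp_incl_tensorHom_eq_of_pieces_lift` — the `X × X`-POINT form: every `Ω`-point `z` of `X × X` lying in `∇X` (underlying
  point in the image of `∇X ↪ X × X`) is `Q ≫ (∇Y ↪ Y × Y) ≫ (u × u)` for an `Ω`-point `Q` of `∇Y` (the shape in which a lift of a
  special-fibre point of a model of `X × X` arrives; coordinates by `Nabla.map_comp_incl_fst_snd_of_comp_eq`).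
* `Nabla.exists_pair_lift_algPoints_of_pieces_lift` — the PAIR form consumed by the reduction argument: for `Ω`-points `x, y` of `X` with
  `(x, y) ∈ ∇X` there are `Ω`-points `x̃, ỹ` of `Y` over `x, y` with `(x̃, ỹ) ∈ ∇Y` («same component upstairs»).
* `Sec42Data.surjective_nablaTr_left_of_pieces_lift`, `Sec42Data.exists_comp_nablaTr_eq_algPoints_of_pieces_lift`,
  `Sec42Data.exists_pair_lift_algPoints_of_pieces_lift`, `Sec42Data.exists_comp_incl_tensorHom_eq_of_pieces_lift` — the §4.2 tower instantiation (`X_K = S̃h(𝕍)_K` smooth projective of dimension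
  `n − 1`, §4.2 l. 2064; `∇u^{K'}_K` the restriction of `u × u`, `Sec42Data.nablaTr_incl`), with the pieces binders in EXACTLY the shape
  of ★ `Sec42Data.epi_Atr_of_pieces_lift` (so a record curve feeds them with ★ `RecordSystemGS.pieces_pair_lift f`, cf.
  `albTransitionEpi_GSM`).

In Liu's proof of Thm. 4.18 (1) ∕ App. D this is the lifting of pairs of points along the «generically finite dominant» transitions
(§4.2 l. 2064); for Shimura varieties it is [Deligne1979] 2.1.2–2.1.4 (`[z, aK'] ↦ [z, aK]` on `⊔_g Γ_g \ X⁺`).  HC_CM is proved only modulo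
the 7 printed citations until rung 0 closes; nothing here discharges a COR-CM binder.  Ours (formalisation glue); axioms `propext`,
`Classical.choice`, `Quot.sound`.

## References
* [Liu2021] Y. Liu, arXiv:2102.11518 = Camb. J. Math. 9 (2021): §2.1 Def. 2.1 (1) (l. 1171–1176), proof of the Proposition
  (l. 1194–1200), §4.2 l. 2060–2072, proof of Thm. 4.18 (1) (l. 2247–2282).
* [Lang1983AbelianVarieties] S. Lang, *Abelian Varieties* (Springer 1983 reprint), Ch. II §3 Prop. 7 (p. 48).
* [GortzWedhorn2020] U. Görtz, T. Wedhorn, *Algebraic Geometry I*, 2nd ed. (2020): Cor. 3.36 (p. 83), Prop. 4.8 (p. 98) (points over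
  algebraically closed fields), Prop. 3.35 (very dense subsets), Prop. 4.16 ∕ Prop. 4.32 (base change).
* [Deligne1979ShimuraVarieties] P. Deligne, *Variétés de Shimura*, Proc. Symp. Pure Math. 33.2 (1979), 2.1.2–2.1.4.
-/

set_option autoImplicit false

noncomputable section

open CategoryTheory CategoryTheory.Limits AlgebraicGeometry MonoidalCategory CartesianMonoidalCategory
open Literature.AlgebraicGeometry.Motives

namespace Literature.NumberTheory.Automorphic.Liu2021.AppendixC

open AbelianVariety (bcSpec bcFunctor)

/-! ## §0 `Ω`-points lift along surjective morphisms locally of finite type -/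

/-- **`Ω`-points lift along a surjective `k`-morphism locally of finite type** (`Ω ⊇ k` algebraically closed): for `g : W → Z` over `k`
with `g` surjective and locally of finite type, every `P : Spec Ω → Z` over `k` is `Q ≫ g` for some `Q : Spec Ω → W` over `k` — a closed
point of the non-empty Jacobson scheme `W ×_Z Spec Ω`, read as an `Ω`-point by the Nullstellensatz (★ `Morphisms.exists_over_comp_eq_of_surjective`,
here in the `AlgPoints` vocabulary `AlgPoints Z Ω = (specOver k Ω ⟶ Z)`). [cite: GortzWedhorn2020, Cor. 3.36 (p. 83) and Prop. 4.8 (p. 98)] -/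
theorem _root_.Literature.AlgebraicGeometry.Motives.SchemeOver.exists_algPoints_comp_eq_of_surjective {k : Type} [Field k]
    (Ω : Type) [Field Ω] [Algebra k Ω] [IsAlgClosed Ω] {W Z : SchemeOver k} (g : W ⟶ Z) [Surjective g.left]
    [LocallyOfFiniteType g.left] (P : AlgPoints Z Ω) : ∃ Q : AlgPoints W Ω, Q ≫ g = P :=
  Literature.AlgebraicGeometry.Morphisms.exists_over_comp_eq_of_surjective g (Spec.map (CommRingCat.ofHom (algebraMap k Ω))) P

/-! ## §1 `∇u` is a surjective morphism of schemes, from the same-piece lifting -/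

section Complex

variable {k : Type} [Field k] [Algebra k ℂ]

set_option backward.isDefEq.respectTransparency false in
/-- **`∇u : ∇Y → ∇X` is a SURJECTIVE morphism of schemes, from the same-piece lifting of pairs of complex points** (`k ⊆ ℂ` of
characteristic zero; `u : Y → X` over `k` with `X` smooth of relative dimension `d` and projective and `Y` projective; ANY carriers `∇X`,
`∇Y` and `ν` with `ν ≫ (∇X ↪ X × X) = (∇Y ↪ Y × Y) ≫ (u × u)`; a colimit cofan `inj_c : P_c → X_ℂ` of geometrically irreducible complex
pieces, a geometrically irreducible family `inj'_{c'} : P'_{c'} → Y_ℂ`, and `hlift`: two complex points of one `P_c` are the images under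
`u_ℂ` of two complex points of ONE `P'_{c'}`).  Proof: `ν` is universally closed (`∇Y ↪ Y × Y` is a closed immersion, `u × u` is a morphism
of proper `k`-schemes, `∇X ↪ X × X` is separated), every `ℂ`-point of `∇X` lifts along `ν` (★ `Nabla.exists_comp_eq_of_pieces_lift`) and
`∇X` is locally of finite type (★ `Nabla.locallyOfFiniteType_hom`), so ★ `SchemeOver.surjective_left_of_forall_algPoints` applies.
Compare ★ `Nabla.surjective_left_of_surjective_of_smooth` (pieces produced internally, `Y` smooth) and ★ `Nabla.surjective_map_left`
(`u` universally open). [cite: Liu2021, §2.1 Def. 2.1 (1) (l. 1171–1176) and §4.2 l. 2060–2072]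
[cite: Lang1983AbelianVarieties, Ch. II §3 Prop. 7 (p. 48)] [cite: GortzWedhorn2020, Cor. 3.36 (p. 83) and Prop. 3.35] -/
theorem Nabla.surjective_left_of_pieces_lift [CharZero k] {d : ℕ} {X Y : SchemeOver k} [SmoothOfRelativeDimension d X.hom]
    (hX : IsProjectiveOver X) (hY : IsProjectiveOver Y) (N : Nabla X) (N' : Nabla Y) (u : Y ⟶ X) (ν : N'.N ⟶ N.N)
    (hν : ν ≫ N.incl = N'.incl ≫ (u ⊗ₘ u))
    {κ κ' : Type} {P : κ → SchemeOver ℂ} {P' : κ' → SchemeOver ℂ}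
    (inj : ∀ c, P c ⟶ (bcFunctor k ℂ).obj X) [∀ c, GeometricallyIrreducible (P c).hom]
    (hcol : IsColimit (Cofan.mk ((bcFunctor k ℂ).obj X) inj))
    (inj' : ∀ c', P' c' ⟶ (bcFunctor k ℂ).obj Y) [∀ c', GeometricallyIrreducible (P' c').hom]
    (hlift : ∀ (c : κ) (z₁ z₂ : ComplexPoints (P c)), ∃ (c' : κ') (z₁' z₂' : ComplexPoints (P' c')),
      AlgPoints.map (inj' c' ≫ (bcFunctor k ℂ).map u) z₁' = AlgPoints.map (inj c) z₁ ∧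
        AlgPoints.map (inj' c' ≫ (bcFunctor k ℂ).map u) z₂' = AlgPoints.map (inj c) z₂) :
    Surjective ν.left := by
  haveI : IsProper X.hom := hX.isProper
  haveI : IsProper Y.hom := hY.isProper
  haveI : IsClosedImmersion N'.incl.left := N'.isClosedImmersion_incl
  haveI : IsClosedImmersion N.incl.left := N.isClosedImmersion_incl
  haveI := Nabla.locallyOfFiniteType_hom (d := d) N
  -- `u × u` is universally closed: `(u × u) ≫ (X × X → Spec k) = (Y × Y → Spec k)` is proper and `X × X → Spec k` is separated
  haveI : UniversallyClosed (Y ⊗ Y).hom := by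
    rw [Over.tensorObj_hom]
    infer_instance
  haveI : IsSeparated (X ⊗ X).hom := by
    rw [Over.tensorObj_hom]
    infer_instance
  haveI : UniversallyClosed ((u ⊗ₘ u).left ≫ (X ⊗ X).hom) := by
    rw [Over.w (u ⊗ₘ u)]
    infer_instance
  haveI : UniversallyClosed (u ⊗ₘ u).left := UniversallyClosed.of_comp_of_isSeparated _ (X ⊗ X).hom
  -- hence so is `ν`: `ν ≫ (∇X ↪ X × X) = (∇Y ↪ Y × Y) ≫ (u × u)`
  haveI : UniversallyClosed (ν.left ≫ N.incl.left) := by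
    rw [← Over.comp_left, hν, Over.comp_left]
    infer_instance
  haveI : UniversallyClosed ν.left := UniversallyClosed.of_comp_of_isSeparated _ N.incl.left
  exact SchemeOver.surjective_left_of_forall_algPoints ℂ ν
    (Nabla.exists_comp_eq_of_pieces_lift (d := d) hX N N' u ν hν inj hcol inj' hlift)

/-! ## §2 `Ω`-points of `∇X` lift along `∇u`, `Ω` any algebraically closed field over `k` -/

omit [Algebra k ℂ] in
/-- `∇u` is locally of finite type as soon as `Y` is (it is a morphism between the `k`-schemes `∇Y ↪ Y × Y` and `∇X`, and a morphism whose
composite with a morphism is locally of finite type is locally of finite type). [cite: GortzWedhorn2020, Prop. 10.7 (p. 248)] -/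
theorem Nabla.locallyOfFiniteType_left {X Y : SchemeOver k} (N : Nabla X) (N' : Nabla Y) (ν : N'.N ⟶ N.N)
    [LocallyOfFiniteType Y.hom] : LocallyOfFiniteType ν.left := by
  haveI : IsClosedImmersion N'.incl.left := N'.isClosedImmersion_incl
  haveI : LocallyOfFiniteType (Y ⊗ Y).hom := by
    have h1 : LocallyOfFiniteType (pullback.fst Y.hom Y.hom) := MorphismProperty.pullback_fst _ _ ‹_›
    rw [Over.tensorObj_hom]
    exact MorphismProperty.comp_mem _ _ _ h1 ‹_›
  haveI : LocallyOfFiniteType (N'.incl.left ≫ (Y ⊗ Y).hom) := inferInstance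
  haveI : LocallyOfFiniteType N'.N.hom := by
    rw [← Over.w N'.incl]
    infer_instance
  haveI : LocallyOfFiniteType (ν.left ≫ N.N.hom) := by
    rw [Over.w ν]
    infer_instance
  exact locallyOfFiniteType_of_comp ν.left N.N.hom

/-- **Every `Ω`-point of `∇X` lifts along `∇u`, for EVERY algebraically closed `Ω` over `k`, from the same-piece lifting** (data as in
`Nabla.surjective_left_of_pieces_lift`; `Ω` a field with `[Algebra k Ω] [IsAlgClosed Ω]` — e.g. `Ω = \overline{F_w}` in a reduction
argument, NOT necessarily `ℂ`).  CONCLUSION: every `Pt : Spec Ω → ∇X` over `k` factors as `Q ≫ ν`.  Proof: `ν` is surjective as a morphism of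
schemes (§1) and locally of finite type, and geometric points lift along such morphisms (§0).  The `Ω`-form of ★
`Nabla.exists_comp_eq_of_pieces_lift` (`Ω = ℂ`). [cite: Liu2021, §2.1 Def. 2.1 (1) (l. 1171–1176) and §4.2 l. 2060–2072]
[cite: GortzWedhorn2020, Cor. 3.36 (p. 83) and Prop. 4.8 (p. 98)] [cite: Lang1983AbelianVarieties, Ch. II §3 Prop. 7 (p. 48)] -/
theorem Nabla.exists_comp_eq_algPoints_of_pieces_lift [CharZero k] {d : ℕ} {X Y : SchemeOver k} [SmoothOfRelativeDimension d X.hom]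
    (hX : IsProjectiveOver X) (hY : IsProjectiveOver Y) (N : Nabla X) (N' : Nabla Y) (u : Y ⟶ X) (ν : N'.N ⟶ N.N)
    (hν : ν ≫ N.incl = N'.incl ≫ (u ⊗ₘ u))
    {κ κ' : Type} {P : κ → SchemeOver ℂ} {P' : κ' → SchemeOver ℂ}
    (inj : ∀ c, P c ⟶ (bcFunctor k ℂ).obj X) [∀ c, GeometricallyIrreducible (P c).hom]
    (hcol : IsColimit (Cofan.mk ((bcFunctor k ℂ).obj X) inj))
    (inj' : ∀ c', P' c' ⟶ (bcFunctor k ℂ).obj Y) [∀ c', GeometricallyIrreducible (P' c').hom]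
    (hlift : ∀ (c : κ) (z₁ z₂ : ComplexPoints (P c)), ∃ (c' : κ') (z₁' z₂' : ComplexPoints (P' c')),
      AlgPoints.map (inj' c' ≫ (bcFunctor k ℂ).map u) z₁' = AlgPoints.map (inj c) z₁ ∧
        AlgPoints.map (inj' c' ≫ (bcFunctor k ℂ).map u) z₂' = AlgPoints.map (inj c) z₂)
    (Ω : Type) [Field Ω] [Algebra k Ω] [IsAlgClosed Ω] :
    ∀ Pt : AlgPoints N.N Ω, ∃ Q : AlgPoints N'.N Ω, Q ≫ ν = Pt := by
  haveI : Surjective ν.left := Nabla.surjective_left_of_pieces_lift (d := d) hX hY N N' u ν hν inj hcol inj' hlift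
  haveI : IsProper Y.hom := hY.isProper
  haveI : LocallyOfFiniteType ν.left := Nabla.locallyOfFiniteType_left N N' ν
  exact fun Pt => SchemeOver.exists_algPoints_comp_eq_of_surjective Ω ν Pt

/-- **Every `Ω`-point of `∇X` lifts along `∇u` for `u` SURJECTIVE between smooth projective `k`-schemes, `Ω` ANY algebraically closed field
over `k`** (`k ⊆ ℂ` of characteristic zero; `X`, `Y` smooth of relative dimensions `d`, `d'` and projective; any carriers and `ν` over
`u × u`).  The `Ω`-form of ★ `Nabla.exists_comp_eq_of_surjective_of_smooth` (`Ω = ℂ`): ★ `Nabla.surjective_left_of_surjective_of_smooth` + §0.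
[cite: Liu2021, §2.1 Def. 2.1 (1) (l. 1171–1176) and §4.2 l. 2060–2072] [cite: Lang1983AbelianVarieties, Ch. II §3 Prop. 7 (p. 48)]
[cite: GortzWedhorn2020, Cor. 3.36 (p. 83) and Prop. 4.8 (p. 98)] -/
theorem Nabla.exists_comp_eq_algPoints_of_surjective_of_smooth [CharZero k] {d d' : ℕ} {X Y : SchemeOver k}
    [SmoothOfRelativeDimension d X.hom] [SmoothOfRelativeDimension d' Y.hom] (hX : IsProjectiveOver X) (hY : IsProjectiveOver Y)
    (N : Nabla X) (N' : Nabla Y) (u : Y ⟶ X) [Surjective u.left] (ν : N'.N ⟶ N.N) (hν : ν ≫ N.incl = N'.incl ≫ (u ⊗ₘ u))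
    (Ω : Type) [Field Ω] [Algebra k Ω] [IsAlgClosed Ω] :
    ∀ Pt : AlgPoints N.N Ω, ∃ Q : AlgPoints N'.N Ω, Q ≫ ν = Pt := by
  haveI : Surjective ν.left := Nabla.surjective_left_of_surjective_of_smooth (d := d) (d' := d') hX hY N N' u ν hν
  haveI : IsProper Y.hom := hY.isProper
  haveI : LocallyOfFiniteType ν.left := Nabla.locallyOfFiniteType_left N N' ν
  exact fun Pt => SchemeOver.exists_algPoints_comp_eq_of_surjective Ω ν Pt

end Complex

/-! ## §3 The pair form: `(x, y) ∈ ∇X` lifts to `(x̃, ỹ) ∈ ∇Y` over `(x, y)` -/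

section Pairs

variable {k : Type} [Field k] {Ω : Type} [Field Ω] [Algebra k Ω]

/-- **Pairs in `∇X` lift to pairs in `∇Y`, from the lifting of `Ω`-points of `∇X` along `∇u`** (pure bookkeeping, any field `Ω` over `k`,
any `k`-schemes): if every `Ω`-point of `∇X` lifts along `ν : ∇Y → ∇X` (with `ν ≫ (∇X ↪ X × X) = (∇Y ↪ Y × Y) ≫ (u × u)`), then for
`Ω`-points `x, y` of `X` whose pair `(x, y) : Spec Ω → X × X` lies in the open subscheme `∇X` there are `Ω`-points `x̃, ỹ` of `Y` with
`u(x̃) = x`, `u(ỹ) = y` and `(x̃, ỹ)` in `∇Y`.  Proof: `(x, y)` factors through the open immersion `∇X ↪ X × X`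
(★ `AlgPoints.exists_comp_eq_of_pt_mem_range`), lift the factorisation along `ν`, project. [cite: Liu2021, §2.1 Def. 2.1 (1) (l. 1171–1176)]
[cite: Hartshorne1977, II Ex. 2.7 and II.3 Thm. 3.3] -/
theorem Nabla.exists_pair_lift_algPoints_of_forall_comp_eq {X Y : SchemeOver k} (N : Nabla X) (N' : Nabla Y) (u : Y ⟶ X)
    (ν : N'.N ⟶ N.N) (hν : ν ≫ N.incl = N'.incl ≫ (u ⊗ₘ u)) (h : ∀ Pt : AlgPoints N.N Ω, ∃ Q : AlgPoints N'.N Ω, Q ≫ ν = Pt)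
    (x y : AlgPoints X Ω) (hxy : AlgPoints.pt (lift x y : AlgPoints (X ⊗ X) Ω) ∈ Set.range ⇑N.incl.left) :
    ∃ x' y' : AlgPoints Y Ω, AlgPoints.map u x' = x ∧ AlgPoints.map u y' = y ∧
      AlgPoints.pt (lift x' y' : AlgPoints (Y ⊗ Y) Ω) ∈ Set.range ⇑N'.incl.left := by
  haveI : IsOpenImmersion N.incl.left := N.isOpenImmersion_incl
  obtain ⟨Pt, hPt⟩ := AlgPoints.exists_comp_eq_of_pt_mem_range N.incl (lift x y) hxy
  obtain ⟨Q, hQ⟩ := h Pt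
  have hQ' : Q ≫ N'.incl ≫ (u ⊗ₘ u) = lift x y := by rw [← hν, ← Category.assoc, hQ, hPt]
  refine ⟨Q ≫ N'.incl ≫ fst Y Y, Q ≫ N'.incl ≫ snd Y Y, ?_, ?_, ?_⟩
  · rw [AlgPoints.map_apply, Category.assoc, Category.assoc, ← tensorHom_fst u u, ← Category.assoc (N'.incl), ← Category.assoc Q, hQ',
      lift_fst]
  · rw [AlgPoints.map_apply, Category.assoc, Category.assoc, ← tensorHom_snd u u, ← Category.assoc (N'.incl), ← Category.assoc Q, hQ',
      lift_snd]
  · have hpair : (lift (Q ≫ N'.incl ≫ fst Y Y) (Q ≫ N'.incl ≫ snd Y Y) : AlgPoints (Y ⊗ Y) Ω) = AlgPoints.map N'.incl Q := by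
      rw [AlgPoints.map_apply, ← Category.assoc, ← Category.assoc, ← comp_lift, lift_fst_snd, Category.comp_id]
    rw [hpair, AlgPoints.pt_map]
    exact ⟨Q.pt, rfl⟩

/-- Conversely-shaped reading of membership: an `Ω`-point of `X × X` lies in `∇X` iff it factors through `∇X ↪ X × X`; the pair of an
`Ω`-point `Pt` of `∇X` is `(Pt ≫ incl ≫ fst, Pt ≫ incl ≫ snd)` and lies in `∇X`. [cite: Liu2021, §2.1 Def. 2.1 (1) (l. 1171–1176)] -/
theorem Nabla.pt_lift_mem_range_incl {X : SchemeOver k} (N : Nabla X) (Pt : AlgPoints N.N Ω) :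
    AlgPoints.pt (lift (Pt ≫ N.incl ≫ fst X X) (Pt ≫ N.incl ≫ snd X X) : AlgPoints (X ⊗ X) Ω) ∈ Set.range ⇑N.incl.left := by
  have hpair : (lift (Pt ≫ N.incl ≫ fst X X) (Pt ≫ N.incl ≫ snd X X) : AlgPoints (X ⊗ X) Ω) = AlgPoints.map N.incl Pt := by
    rw [AlgPoints.map_apply, ← Category.assoc, ← Category.assoc, ← comp_lift, lift_fst_snd, Category.comp_id]
  rw [hpair, AlgPoints.pt_map]
  exact ⟨Pt.pt, rfl⟩

/-- **The `X × X`-point form** (pure bookkeeping, any field `Ω` over `k`): if every `Ω`-point of `∇X` lifts along `ν : ∇Y → ∇X` (with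
`ν ≫ (∇X ↪ X × X) = (∇Y ↪ Y × Y) ≫ (u × u)`), then every `Ω`-point `z` of `X × X` LYING IN `∇X` (its underlying point is in the image of the open
immersion `∇X ↪ X × X` — e.g. the generic fibre of a lift of a special-fibre point of a model of `X × X`) is `Q ≫ (∇Y ↪ Y × Y) ≫ (u × u)` for an
`Ω`-point `Q` of `∇Y`; its two coordinates `Q ≫ incl ≫ fst`, `Q ≫ incl ≫ snd` are then `Ω`-points of `Y` over the coordinates of `z`, in one
component.  Proof: `z` factors through the open immersion (★ `AlgPoints.exists_comp_eq_of_pt_mem_range`), then lift along `ν`.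
[cite: Liu2021, §2.1 Def. 2.1 (1) (l. 1171–1176)] [cite: Hartshorne1977, II Ex. 2.7 and II.3 Thm. 3.3] -/
theorem Nabla.exists_comp_incl_tensorHom_eq_of_forall_comp_eq {X Y : SchemeOver k} (N : Nabla X) (N' : Nabla Y) (u : Y ⟶ X)
    (ν : N'.N ⟶ N.N) (hν : ν ≫ N.incl = N'.incl ≫ (u ⊗ₘ u)) (h : ∀ Pt : AlgPoints N.N Ω, ∃ Q : AlgPoints N'.N Ω, Q ≫ ν = Pt)
    (z : AlgPoints (X ⊗ X) Ω) (hz : z.pt ∈ Set.range ⇑N.incl.left) :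
    ∃ Q : AlgPoints N'.N Ω, Q ≫ N'.incl ≫ (u ⊗ₘ u) = z := by
  haveI : IsOpenImmersion N.incl.left := N.isOpenImmersion_incl
  obtain ⟨Pt, hPt⟩ := AlgPoints.exists_comp_eq_of_pt_mem_range N.incl z hz
  obtain ⟨Q, hQ⟩ := h Pt
  exact ⟨Q, by rw [← hν, ← Category.assoc, hQ, hPt]⟩

/-- The coordinates of such a lift: `u (Q ≫ incl ≫ fst) = z ≫ fst` and `u (Q ≫ incl ≫ snd) = z ≫ snd`. [cite: Hartshorne1977, II.3 Thm. 3.3] -/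
theorem Nabla.map_comp_incl_fst_snd_of_comp_eq {X Y : SchemeOver k} (N' : Nabla Y) (u : Y ⟶ X) (Q : AlgPoints N'.N Ω)
    (z : AlgPoints (X ⊗ X) Ω) (hQ : Q ≫ N'.incl ≫ (u ⊗ₘ u) = z) :
    AlgPoints.map u (Q ≫ N'.incl ≫ fst Y Y) = z ≫ fst X X ∧ AlgPoints.map u (Q ≫ N'.incl ≫ snd Y Y) = z ≫ snd X X := by
  constructor
  · rw [AlgPoints.map_apply, Category.assoc, Category.assoc, ← tensorHom_fst u u, ← Category.assoc (N'.incl), ← Category.assoc Q, hQ]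
  · rw [AlgPoints.map_apply, Category.assoc, Category.assoc, ← tensorHom_snd u u, ← Category.assoc (N'.incl), ← Category.assoc Q, hQ]

variable [Algebra k ℂ]

/-- **The `X × X`-point form of §2** (`k ⊆ ℂ` of characteristic zero, `X` smooth of relative dimension `d` and projective, `Y` projective, complex
pieces and same-piece lifting as in `Nabla.surjective_left_of_pieces_lift`, `Ω` ANY algebraically closed field over `k`): every `Ω`-point `z` of
`X × X` lying in `∇X` is `Q ≫ (∇Y ↪ Y × Y) ≫ (u × u)` for an `Ω`-point `Q` of `∇Y`.
[cite: Liu2021, §2.1 Def. 2.1 (1) (l. 1171–1176) and §4.2 l. 2060–2072] [cite: Deligne1979ShimuraVarieties, 2.1.2–2.1.4]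
[cite: GortzWedhorn2020, Cor. 3.36 (p. 83) and Prop. 4.8 (p. 98)] -/
theorem Nabla.exists_comp_incl_tensorHom_eq_of_pieces_lift [IsAlgClosed Ω] [CharZero k] {d : ℕ} {X Y : SchemeOver k}
    [SmoothOfRelativeDimension d X.hom] (hX : IsProjectiveOver X) (hY : IsProjectiveOver Y) (N : Nabla X) (N' : Nabla Y) (u : Y ⟶ X)
    (ν : N'.N ⟶ N.N) (hν : ν ≫ N.incl = N'.incl ≫ (u ⊗ₘ u))
    {κ κ' : Type} {P : κ → SchemeOver ℂ} {P' : κ' → SchemeOver ℂ}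
    (inj : ∀ c, P c ⟶ (bcFunctor k ℂ).obj X) [∀ c, GeometricallyIrreducible (P c).hom]
    (hcol : IsColimit (Cofan.mk ((bcFunctor k ℂ).obj X) inj))
    (inj' : ∀ c', P' c' ⟶ (bcFunctor k ℂ).obj Y) [∀ c', GeometricallyIrreducible (P' c').hom]
    (hlift : ∀ (c : κ) (z₁ z₂ : ComplexPoints (P c)), ∃ (c' : κ') (z₁' z₂' : ComplexPoints (P' c')),
      AlgPoints.map (inj' c' ≫ (bcFunctor k ℂ).map u) z₁' = AlgPoints.map (inj c) z₁ ∧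
        AlgPoints.map (inj' c' ≫ (bcFunctor k ℂ).map u) z₂' = AlgPoints.map (inj c) z₂)
    (z : AlgPoints (X ⊗ X) Ω) (hz : z.pt ∈ Set.range ⇑N.incl.left) :
    ∃ Q : AlgPoints N'.N Ω, Q ≫ N'.incl ≫ (u ⊗ₘ u) = z :=
  Nabla.exists_comp_incl_tensorHom_eq_of_forall_comp_eq N N' u ν hν
    (Nabla.exists_comp_eq_algPoints_of_pieces_lift (d := d) hX hY N N' u ν hν inj hcol inj' hlift Ω) z hz

/-- **The pair form of §2** (`k ⊆ ℂ` of characteristic zero, `X` smooth of relative dimension `d` and projective, `Y` projective, complex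
pieces and same-piece lifting as in `Nabla.surjective_left_of_pieces_lift`, `Ω` ANY algebraically closed field over `k`): for `Ω`-points
`x, y` of `X` with `(x, y) ∈ ∇X` there are `Ω`-points `x̃, ỹ` of `Y` with `u(x̃) = x`, `u(ỹ) = y`, `(x̃, ỹ) ∈ ∇Y` — «lift `(x, y) ∈ ∇_K` to
`∇_N`: the two lifts can be chosen in the same component upstairs».  [cite: Liu2021, §2.1 Def. 2.1 (1) (l. 1171–1176) and §4.2 l. 2060–2072]
[cite: Deligne1979ShimuraVarieties, 2.1.2–2.1.4] [cite: GortzWedhorn2020, Cor. 3.36 (p. 83) and Prop. 4.8 (p. 98)] -/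
theorem Nabla.exists_pair_lift_algPoints_of_pieces_lift [IsAlgClosed Ω] [CharZero k] {d : ℕ} {X Y : SchemeOver k}
    [SmoothOfRelativeDimension d X.hom] (hX : IsProjectiveOver X) (hY : IsProjectiveOver Y) (N : Nabla X) (N' : Nabla Y) (u : Y ⟶ X)
    (ν : N'.N ⟶ N.N) (hν : ν ≫ N.incl = N'.incl ≫ (u ⊗ₘ u))
    {κ κ' : Type} {P : κ → SchemeOver ℂ} {P' : κ' → SchemeOver ℂ}
    (inj : ∀ c, P c ⟶ (bcFunctor k ℂ).obj X) [∀ c, GeometricallyIrreducible (P c).hom]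
    (hcol : IsColimit (Cofan.mk ((bcFunctor k ℂ).obj X) inj))
    (inj' : ∀ c', P' c' ⟶ (bcFunctor k ℂ).obj Y) [∀ c', GeometricallyIrreducible (P' c').hom]
    (hlift : ∀ (c : κ) (z₁ z₂ : ComplexPoints (P c)), ∃ (c' : κ') (z₁' z₂' : ComplexPoints (P' c')),
      AlgPoints.map (inj' c' ≫ (bcFunctor k ℂ).map u) z₁' = AlgPoints.map (inj c) z₁ ∧
        AlgPoints.map (inj' c' ≫ (bcFunctor k ℂ).map u) z₂' = AlgPoints.map (inj c) z₂)
    (x y : AlgPoints X Ω) (hxy : AlgPoints.pt (lift x y : AlgPoints (X ⊗ X) Ω) ∈ Set.range ⇑N.incl.left) :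
    ∃ x' y' : AlgPoints Y Ω, AlgPoints.map u x' = x ∧ AlgPoints.map u y' = y ∧
      AlgPoints.pt (lift x' y' : AlgPoints (Y ⊗ Y) Ω) ∈ Set.range ⇑N'.incl.left :=
  Nabla.exists_pair_lift_algPoints_of_forall_comp_eq N N' u ν hν
    (Nabla.exists_comp_eq_algPoints_of_pieces_lift (d := d) hX hY N N' u ν hν inj hcol inj' hlift Ω) x y hxy

end Pairs

/-! ## §4 The §4.2 tower: `Ω`-points of `∇X_K` lift along `∇u^{K'}_K` -/

namespace Sec42Data

set_option backward.isDefEq.respectTransparency false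

variable {F E : Type} [Field F] [NumberField F] [NumberField.IsTotallyReal F] [Field E] [NumberField E] [Algebra F E]
  [NumberField.IsTotallyComplex E] [Algebra.IsQuadraticExtension F E]
variable {P5 : PropC5Data F E} {isotropicAt : ℕ → Prop} (C : Sec42Data P5 isotropicAt)

/-- **`∇u^{K'}_K` is a SURJECTIVE morphism of schemes as soon as same-piece pairs of complex points of `X_K` lift along `u^{K'}_K`**
(§4.2 datum `C`, `E ⊆ ℂ` by `[Algebra E ℂ]`; pieces binders exactly as in ★ `Sec42Data.epi_Atr_of_pieces_lift`): `X_K`, `X_{K'}` are smooth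
projective of relative dimension `n − 1` (`CompactifiedSystem.smooth_X ∕ projective_X`, §4.2 l. 2064) and `∇u^{K'}_K` is the restriction of
`u × u` (`Sec42Data.nablaTr_incl`), so §1 applies. [cite: Liu2021, §4.2 l. 2060–2072 and Def. 2.1 (1)] [cite: Deligne1979ShimuraVarieties, 2.1.2–2.1.4] -/
theorem surjective_nablaTr_left_of_pieces_lift [Algebra E ℂ] {K K' : C5.SmallLevel C.S.K₀} (f : K' ⟶ K)
    {κ κ' : Type} {P : κ → SchemeOver ℂ} {P' : κ' → SchemeOver ℂ}
    (inj : ∀ c, P c ⟶ (bcFunctor E ℂ).obj (C.X K)) [∀ c, GeometricallyIrreducible (P c).hom]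
    (hcol : IsColimit (Cofan.mk ((bcFunctor E ℂ).obj (C.X K)) inj))
    (inj' : ∀ c', P' c' ⟶ (bcFunctor E ℂ).obj (C.X K')) [∀ c', GeometricallyIrreducible (P' c').hom]
    (hlift : ∀ (c : κ) (z₁ z₂ : ComplexPoints (P c)), ∃ (c' : κ') (z₁' z₂' : ComplexPoints (P' c')),
      AlgPoints.map (inj' c' ≫ (bcFunctor E ℂ).map (C.cpt.X.map f)) z₁' = AlgPoints.map (inj c) z₁ ∧
        AlgPoints.map (inj' c' ≫ (bcFunctor E ℂ).map (C.cpt.X.map f)) z₂' = AlgPoints.map (inj c) z₂) :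
    Surjective (C.nablaTr f).left := by
  haveI := C.cpt.smooth_X K
  exact Nabla.surjective_left_of_pieces_lift (d := P5.n - 1) (C.cpt.projective_X K) (C.cpt.projective_X K') (C.alb K).nabla
    (C.alb K').nabla (C.cpt.X.map f) (C.nablaTr f) (C.nablaTr_incl f) inj hcol inj' hlift

/-- **Every `Ω`-point of `∇X_K` lifts along `∇u^{K'}_K`, `Ω` ANY algebraically closed field over `E`, as soon as same-piece pairs of complex
points of `X_K` lift along `u^{K'}_K`** (§4.2 datum `C`; pieces binders exactly as in ★ `Sec42Data.epi_Atr_of_pieces_lift`, so that a record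
curve feeds them with ★ `RecordSystemGS.pieces_pair_lift f`; `Ω` with `[Algebra E Ω] [IsAlgClosed Ω]`, e.g. `\overline{E_w}`).  §2 on the
§4.2 tower. [cite: Liu2021, §4.2 l. 2060–2072, Thm. 4.18 (1) proof l. 2247–2282 and Def. 2.1 (1)] [cite: Deligne1979ShimuraVarieties, 2.1.2–2.1.4]
[cite: GortzWedhorn2020, Cor. 3.36 (p. 83) and Prop. 4.8 (p. 98)] -/
theorem exists_comp_nablaTr_eq_algPoints_of_pieces_lift [Algebra E ℂ] {K K' : C5.SmallLevel C.S.K₀} (f : K' ⟶ K)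
    {κ κ' : Type} {P : κ → SchemeOver ℂ} {P' : κ' → SchemeOver ℂ}
    (inj : ∀ c, P c ⟶ (bcFunctor E ℂ).obj (C.X K)) [∀ c, GeometricallyIrreducible (P c).hom]
    (hcol : IsColimit (Cofan.mk ((bcFunctor E ℂ).obj (C.X K)) inj))
    (inj' : ∀ c', P' c' ⟶ (bcFunctor E ℂ).obj (C.X K')) [∀ c', GeometricallyIrreducible (P' c').hom]
    (hlift : ∀ (c : κ) (z₁ z₂ : ComplexPoints (P c)), ∃ (c' : κ') (z₁' z₂' : ComplexPoints (P' c')),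
      AlgPoints.map (inj' c' ≫ (bcFunctor E ℂ).map (C.cpt.X.map f)) z₁' = AlgPoints.map (inj c) z₁ ∧
        AlgPoints.map (inj' c' ≫ (bcFunctor E ℂ).map (C.cpt.X.map f)) z₂' = AlgPoints.map (inj c) z₂)
    (Ω : Type) [Field Ω] [Algebra E Ω] [IsAlgClosed Ω] :
    ∀ Pt : AlgPoints (C.alb K).nabla.N Ω, ∃ Q : AlgPoints (C.alb K').nabla.N Ω, Q ≫ C.nablaTr f = Pt := by
  haveI := C.cpt.smooth_X K
  exact Nabla.exists_comp_eq_algPoints_of_pieces_lift (d := P5.n - 1) (C.cpt.projective_X K) (C.cpt.projective_X K') (C.alb K).nabla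
    (C.alb K').nabla (C.cpt.X.map f) (C.nablaTr f) (C.nablaTr_incl f) inj hcol inj' hlift Ω

/-- **The pair form on the §4.2 tower** (row U of the cell's reduction argument): for `Ω`-points `x, y` of `X_K` with `(x, y) ∈ ∇X_K`
there are `Ω`-points `x̃, ỹ` of `X_{K'}` with `u^{K'}_K(x̃) = x`, `u^{K'}_K(ỹ) = y` and `(x̃, ỹ) ∈ ∇X_{K'}` (`Ω` ANY algebraically closed field over
`E`; pieces binders as in ★ `Sec42Data.epi_Atr_of_pieces_lift`). [cite: Liu2021, §4.2 l. 2060–2072 and Def. 2.1 (1)]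
[cite: Deligne1979ShimuraVarieties, 2.1.2–2.1.4] [cite: GortzWedhorn2020, Cor. 3.36 (p. 83) and Prop. 4.8 (p. 98)] -/
theorem exists_pair_lift_algPoints_of_pieces_lift [Algebra E ℂ] {K K' : C5.SmallLevel C.S.K₀} (f : K' ⟶ K)
    {κ κ' : Type} {P : κ → SchemeOver ℂ} {P' : κ' → SchemeOver ℂ}
    (inj : ∀ c, P c ⟶ (bcFunctor E ℂ).obj (C.X K)) [∀ c, GeometricallyIrreducible (P c).hom]
    (hcol : IsColimit (Cofan.mk ((bcFunctor E ℂ).obj (C.X K)) inj))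
    (inj' : ∀ c', P' c' ⟶ (bcFunctor E ℂ).obj (C.X K')) [∀ c', GeometricallyIrreducible (P' c').hom]
    (hlift : ∀ (c : κ) (z₁ z₂ : ComplexPoints (P c)), ∃ (c' : κ') (z₁' z₂' : ComplexPoints (P' c')),
      AlgPoints.map (inj' c' ≫ (bcFunctor E ℂ).map (C.cpt.X.map f)) z₁' = AlgPoints.map (inj c) z₁ ∧
        AlgPoints.map (inj' c' ≫ (bcFunctor E ℂ).map (C.cpt.X.map f)) z₂' = AlgPoints.map (inj c) z₂)
    {Ω : Type} [Field Ω] [Algebra E Ω] [IsAlgClosed Ω] (x y : AlgPoints (C.X K) Ω)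
    (hxy : AlgPoints.pt (lift x y : AlgPoints (C.X K ⊗ C.X K) Ω) ∈ Set.range ⇑(C.alb K).nabla.incl.left) :
    ∃ x' y' : AlgPoints (C.X K') Ω, AlgPoints.map (C.cpt.X.map f) x' = x ∧ AlgPoints.map (C.cpt.X.map f) y' = y ∧
      AlgPoints.pt (lift x' y' : AlgPoints (C.X K' ⊗ C.X K') Ω) ∈ Set.range ⇑(C.alb K').nabla.incl.left :=
  Nabla.exists_pair_lift_algPoints_of_forall_comp_eq (C.alb K).nabla (C.alb K').nabla (C.cpt.X.map f) (C.nablaTr f) (C.nablaTr_incl f)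
    (C.exists_comp_nablaTr_eq_algPoints_of_pieces_lift f inj hcol inj' hlift Ω) x y hxy

/-- **The `X_K × X_K`-point form on the §4.2 tower** (row U of the cell's reduction argument, in the shape a lift of a special-fibre point of a model of
`X_K × X_K` arrives): every `Ω`-point `z` of `X_K × X_K` lying in `∇X_K` is `Q ≫ (∇X_{K'} ↪ X_{K'} × X_{K'}) ≫ (u^{K'}_K × u^{K'}_K)` for an `Ω`-point `Q` of
`∇X_{K'}` (`Ω` ANY algebraically closed field over `E`; pieces binders as in ★ `Sec42Data.epi_Atr_of_pieces_lift`); coordinates by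
`Nabla.map_comp_incl_fst_snd_of_comp_eq`. [cite: Liu2021, §4.2 l. 2060–2072 and Def. 2.1 (1)] [cite: Deligne1979ShimuraVarieties, 2.1.2–2.1.4]
[cite: GortzWedhorn2020, Cor. 3.36 (p. 83) and Prop. 4.8 (p. 98)] -/
theorem exists_comp_incl_tensorHom_eq_of_pieces_lift [Algebra E ℂ] {K K' : C5.SmallLevel C.S.K₀} (f : K' ⟶ K)
    {κ κ' : Type} {P : κ → SchemeOver ℂ} {P' : κ' → SchemeOver ℂ}
    (inj : ∀ c, P c ⟶ (bcFunctor E ℂ).obj (C.X K)) [∀ c, GeometricallyIrreducible (P c).hom]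
    (hcol : IsColimit (Cofan.mk ((bcFunctor E ℂ).obj (C.X K)) inj))
    (inj' : ∀ c', P' c' ⟶ (bcFunctor E ℂ).obj (C.X K')) [∀ c', GeometricallyIrreducible (P' c').hom]
    (hlift : ∀ (c : κ) (z₁ z₂ : ComplexPoints (P c)), ∃ (c' : κ') (z₁' z₂' : ComplexPoints (P' c')),
      AlgPoints.map (inj' c' ≫ (bcFunctor E ℂ).map (C.cpt.X.map f)) z₁' = AlgPoints.map (inj c) z₁ ∧
        AlgPoints.map (inj' c' ≫ (bcFunctor E ℂ).map (C.cpt.X.map f)) z₂' = AlgPoints.map (inj c) z₂)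
    {Ω : Type} [Field Ω] [Algebra E Ω] [IsAlgClosed Ω] (z : AlgPoints (C.X K ⊗ C.X K) Ω)
    (hz : z.pt ∈ Set.range ⇑(C.alb K).nabla.incl.left) :
    ∃ Q : AlgPoints (C.alb K').nabla.N Ω, Q ≫ (C.alb K').nabla.incl ≫ (C.cpt.X.map f ⊗ₘ C.cpt.X.map f) = z :=
  Nabla.exists_comp_incl_tensorHom_eq_of_forall_comp_eq (C.alb K).nabla (C.alb K').nabla (C.cpt.X.map f) (C.nablaTr f) (C.nablaTr_incl f)
    (C.exists_comp_nablaTr_eq_algPoints_of_pieces_lift f inj hcol inj' hlift Ω) z hz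

end Sec42Data

end Literature.NumberTheory.Automorphic.Liu2021.AppendixC

end
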